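import Summits.ValiantsHypothesis.ValiantsHypothesis.Theses.BarrierLever
import Summits.ValiantsHypothesis.ValiantsHypothesis.Theorems.BarrierLeverPriorityPeelingCertificate

/-!
# Route BarrierLever — bridge: priority-peeling DERIVATIONS give 19761-CERTIFICATES

Helper file (`--supports stmt-ValiantsHypothesis-19761`; cell valiant-natproofs, rung V4, 𝒟-side door
(c); the optional bridge asked for by planner p1-g11). Prover gen 7's certificate format
`PriorityPeeling.PPDerivable nr nc ι e R C` (tree file `…PriorityPeelingCertificate`, p460060: leaves
`rank_zero` / `rank_one` / `single`, moves `pair` (PREFIX pair move) / `shear`, symmetries `transpose` /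
`reindex`) is related to item 19761 `PriorityPeelingCertificatesExist`, which is typed IMPREDICATIVELY:
«every predicate `P` on configurations closed under (0) re-indexing, (1) transposition, (2) the base
cases, (3) the MARKED pair move in block form, (4) the column shear, holds at every injective TT layout».

* `closed_of_ppDerivable` — a derivable configuration satisfies EVERY such closed predicate, after any
  enumeration `en : Fin r ≃ ι` of its index type (induction on the derivation). The prefix `pair`
  constructor is an instance of the marked clause (3) with `prio := BIG + w` on the marked set `P`,
  `w + 1` on `S ∖ P`, `0` elsewhere and `T := P`, after re-enumerating rows / columns block by block
  (`Equiv.sumCompl`, `finSumFinEquiv`) and moving the split slot to slot `0` (`Fin.cycleRange`, clause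
  (0)); `shear` is clause (4) (on injective columns `Function.update` is the item's `if`-map);
  `transpose` / `reindex` are (1) / (0); the leaves are (2). The `r = 2` base clause of 19761 is not
  needed.
* `priorityPeelingCertificatesExist_of_derivations` — gen 7's residual «every injective TT layout has a
  PP derivation» implies the route decl `PriorityPeelingCertificatesExist` (item 19761). So every
  kernel certificate emitted in gen 7's format proves the 19761-instance of its layout.

WHAT THIS IS NOT: neither residual is proved here (both OPEN; censuses only); nothing on TT (19152) in
general, on crux stmt-ValiantsHypothesis-14610, or on VP vs VNP.
-/

-- layout Summits/ValiantsHypothesis/ValiantsHypothesis forces the duplicated namespace component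
set_option linter.dupNamespace false

namespace Summit.ValiantsHypothesis.ValiantsHypothesis.Theorems.BarrierLever.PPBridge

open PriorityPeeling

/-- On an injective column, gen 7's `Function.update` shear map is the item's `if`-map. -/
theorem shear_map_eq {e nc : ℕ} (κ : Fin e → Fin nc) (hκ : Function.Injective κ) (x y : Fin nc)
    (aff : Bool) (qx : Fin e) (haff : aff = true → κ qx = x ∧ ∀ q, κ q ≠ y)
    (hunaff : aff = false → (∀ q, κ q ≠ x) ∨ (∃ q, κ q = y)) :
    (fun c => if κ c = x ∧ (∀ c' : Fin e, κ c' ≠ y) then y else κ c) =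
      (if aff then Function.update κ qx y else κ) := by
  funext c
  cases haf : aff
  · rcases hunaff haf with hx | ⟨q, hq⟩
    · rw [if_neg (fun h => hx c h.1)]
      simp
    · rw [if_neg (fun h => h.2 q hq)]
      simp
  · obtain ⟨hx, hy⟩ := haff haf
    simp only [if_true, Function.update_apply]
    by_cases hc : c = qx
    · subst hc
      rw [if_pos ⟨hx, hy⟩, if_pos rfl]
    · have hcx : κ c ≠ x := fun h => hc (hκ (h.trans hx.symm))
      rw [if_neg (fun h => hcx h.1), if_neg hc]

/-- **Bridge.** A configuration with a priority-peeling derivation satisfies every predicate on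
configurations that is closed under 19761's clauses (0) re-indexing, (1) transposition, (2) base cases
`r = 0`, `r = 1`, `d = 1`, (3) the marked pair move, (4) the column shear — after any enumeration of its
index type. -/
theorem closed_of_ppDerivable
    (Q : (nr nc r d : ℕ) → (Fin r → Fin d → Fin nr) → (Fin r → Fin d → Fin nc) → Prop)
    (h0 : ∀ (nr nc r d : ℕ) (ρ : Fin r → Fin d → Fin nr) (κ : Fin r → Fin d → Fin nc)
      (σ τ : Equiv.Perm (Fin r)) (α β : Fin r → Equiv.Perm (Fin d)),
      Q nr nc r d (fun i a => ρ (σ i) (α i a)) (fun j c => κ (τ j) (β j c)) → Q nr nc r d ρ κ)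
    (h1 : ∀ (nr nc r d : ℕ) (ρ : Fin r → Fin d → Fin nr) (κ : Fin r → Fin d → Fin nc),
      Q nc nr r d κ ρ → Q nr nc r d ρ κ)
    (h2a : ∀ (nr nc d : ℕ) (ρ : Fin 0 → Fin d → Fin nr) (κ : Fin 0 → Fin d → Fin nc),
      Q nr nc 0 d ρ κ)
    (h2b : ∀ (nr nc d : ℕ) (ρ : Fin 1 → Fin d → Fin nr) (κ : Fin 1 → Fin d → Fin nc),
      Function.Injective (ρ 0) → Function.Injective (κ 0) → Q nr nc 1 d ρ κ)
    (h2c : ∀ (nr nc r : ℕ) (ρ : Fin r → Fin 1 → Fin nr) (κ : Fin r → Fin 1 → Fin nc),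
      Function.Injective (fun i => ρ i 0) → Function.Injective (fun j => κ j 0) → Q nr nc r 1 ρ κ)
    (h3 : ∀ (nr nc k m d : ℕ) (ρ : Fin (k + m) → Fin (d + 1) → Fin nr)
      (κ : Fin (k + m) → Fin (d + 1) → Fin nc) (ℓ₀ ℓ₁ : Fin nr) (prio : Fin nc → ℕ)
      (T : Finset (Fin nc)), ℓ₀ ≠ ℓ₁ → (∀ i : Fin k, ρ (Fin.castAdd m i) 0 = ℓ₀) →
      (∀ i : Fin m, ρ (Fin.natAdd k i) 0 = ℓ₁) →
      (∀ (i : Fin (k + m)) (a : Fin d), ρ i a.succ ≠ ℓ₀ ∧ ρ i a.succ ≠ ℓ₁) →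
      (∀ (j : Fin (k + m)) (c : Fin d), prio (κ j c.succ) < prio (κ j 0)) →
      (∀ j : Fin k, κ (Fin.castAdd m j) 0 ∈ T) → (∀ j : Fin m, κ (Fin.natAdd k j) 0 ∉ T) →
      Q nr nc k d (fun i a => ρ (Fin.castAdd m i) a.succ) (fun j c => κ (Fin.castAdd m j) c.succ) →
      Q nr nc m d (fun i a => ρ (Fin.natAdd k i) a.succ) (fun j c => κ (Fin.natAdd k j) c.succ) →
      Q nr nc (k + m) (d + 1) ρ κ)
    (h4 : ∀ (nr nc r d : ℕ) (ρ : Fin r → Fin d → Fin nr) (κ : Fin r → Fin d → Fin nc) (x y : Fin nc),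
      x ≠ y →
      Q nr nc r d ρ (fun j c => if κ j c = x ∧ (∀ c' : Fin d, κ j c' ≠ y) then y else κ j c) →
      Q nr nc r d ρ κ)
    {nr nc : ℕ} {ι : Type} [Fintype ι] [DecidableEq ι] {e : ℕ}
    {R : ι → Fin e → Fin nr} {C : ι → Fin e → Fin nc} (hder : PPDerivable nr nc ι e R C) :
    ∀ (r : ℕ) (en : Fin r ≃ ι), Q nr nc r e (fun i => R (en i)) (fun j => C (en j)) := by
  induction hder with
  | @rank_zero nr nc ι _ _ hsub R C =>
    intro r en
    have hr : r ≤ 1 := by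
      have h := Fintype.card_le_one_iff_subsingleton.mpr hsub
      rwa [← Fintype.card_congr en, Fintype.card_fin] at h
    rcases r with _ | _ | r
    · exact h2a nr nc 0 _ _
    · exact h2b nr nc 0 _ _ (fun a => Fin.elim0 a) (fun a => Fin.elim0 a)
    · omega
  | @rank_one nr nc ι _ _ R C hR hC =>
    intro r en
    exact h2c nr nc r _ _ (fun a b hab => en.injective (hR hab)) (fun a b hab => en.injective (hC hab))
  | @single nr nc ι _ _ e R C i₀ hι hR hC =>
    intro r en
    have hr : r = 1 := by
      have h := Fintype.card_eq_one_iff.mpr ⟨i₀, hι⟩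
      rwa [← Fintype.card_congr en, Fintype.card_fin] at h
    subst hr
    refine h2b nr nc e _ _ ?_ ?_
    · intro a b hab
      have hab' : R (en 0) a = R (en 0) b := hab
      rw [hι (en 0)] at hab'
      exact hR hab'
    · intro a b hab
      have hab' : C (en 0) a = C (en 0) b := hab
      rw [hι (en 0)] at hab'
      exact hC hab'
  | @pair nr nc ι _ _ d R C ℓ₀ ℓ₁ hℓ β pos hpos huniq Pm S w grp qφ hφ₀ hφ₁ f hf h₀ h₁ ih₀ ih₁ =>
    intro r en
    classical
    -- enumerate the two row groups
    obtain ⟨k, ⟨e₀⟩⟩ : ∃ k, Nonempty (Fin k ≃ {x : ι // β x = false}) :=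
      ⟨_, ⟨(Fintype.equivFin {x : ι // β x = false}).symm⟩⟩
    obtain ⟨m, ⟨e₁⟩⟩ : ∃ m, Nonempty (Fin m ≃ {x : ι // ¬ β x = false}) :=
      ⟨_, ⟨(Fintype.equivFin {x : ι // ¬ β x = false}).symm⟩⟩
    let eb : Fin (k + m) ≃ ι :=
      finSumFinEquiv.symm.trans ((e₀.sumCongr e₁).trans (Equiv.sumCompl (fun x => β x = false)))
    have heb₀ : ∀ i : Fin k, eb (Fin.castAdd m i) = ((e₀ i : {x : ι // β x = false}) : ι) := by
      intro i
      simp [eb, Equiv.trans_apply, finSumFinEquiv_symm_apply_castAdd]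
    have heb₁ : ∀ i : Fin m, eb (Fin.natAdd k i) = ((e₁ i : {x : ι // ¬ β x = false}) : ι) := by
      intro i
      simp [eb, Equiv.trans_apply, finSumFinEquiv_symm_apply_natAdd]
    have hβ₀ : ∀ i : Fin k, β (eb (Fin.castAdd m i)) = false := by
      intro i
      rw [heb₀]
      exact (e₀ i).2
    have hβ₁ : ∀ i : Fin m, β (eb (Fin.natAdd k i)) = true := by
      intro i
      rw [heb₁]
      exact bool_eq_true_of_not_eq_false (e₁ i).2
    -- the size of the enumeration
    have hr : r = k + m := by
      have h := (Fintype.card_congr en).trans (Fintype.card_congr eb).symm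
      simpa only [Fintype.card_fin] using h
    subst hr
    -- the re-slotted block configuration
    obtain ⟨ρ, hρ⟩ : ∃ ρ : Fin (k + m) → Fin (d + 1) → Fin nr,
        ∀ i a, ρ i a = R (eb i) ((Fin.cycleRange (pos (eb i))).symm a) := ⟨_, fun _ _ => rfl⟩
    obtain ⟨κ, hκ⟩ : ∃ κ : Fin (k + m) → Fin (d + 1) → Fin nc,
        ∀ j c, κ j c = C (f (eb j)) ((Fin.cycleRange (qφ (f (eb j)))).symm c) := ⟨_, fun _ _ => rfl⟩
    -- the marked priority
    obtain ⟨prio, hprio⟩ : ∃ prio : Fin nc → ℕ, ∀ y, prio y =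
        if y ∈ Pm then Finset.univ.sup w + 2 + w y else if y ∈ S then w y + 1 else 0 :=
      ⟨_, fun _ => rfl⟩
    have hwle : ∀ y, w y ≤ Finset.univ.sup w := fun y => Finset.le_sup (Finset.mem_univ y)
    -- hypotheses of the marked clause
    have hρ₀' : ∀ i : Fin k, ρ (Fin.castAdd m i) 0 = ℓ₀ := by
      intro i
      rw [hρ, Fin.cycleRange_symm_zero, hpos, hβ₀ i]
      rfl
    have hρ₁' : ∀ i : Fin m, ρ (Fin.natAdd k i) 0 = ℓ₁ := by
      intro i
      rw [hρ, Fin.cycleRange_symm_zero, hpos, hβ₁ i]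
      rfl
    have hρ' : ∀ (i : Fin (k + m)) (a : Fin d), ρ i a.succ ≠ ℓ₀ ∧ ρ i a.succ ≠ ℓ₁ := by
      intro i a
      rw [hρ, Fin.cycleRange_symm_succ]
      exact huniq (eb i) _ (Fin.succAbove_ne _ _)
    have hprio' : ∀ (j : Fin (k + m)) (c : Fin d), prio (κ j c.succ) < prio (κ j 0) := by
      intro j c
      rw [hκ, hκ, Fin.cycleRange_symm_zero, Fin.cycleRange_symm_succ, hprio, hprio]
      have hne : (qφ (f (eb j))).succAbove c ≠ qφ (f (eb j)) := Fin.succAbove_ne _ _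
      cases hg : grp (f (eb j))
      · obtain ⟨htop, hlt⟩ := hφ₀ _ hg
        rw [if_pos htop]
        by_cases hq : C (f (eb j)) ((qφ (f (eb j))).succAbove c) ∈ Pm
        · rw [if_pos hq]
          have := hlt _ hq hne
          omega
        · rw [if_neg hq]
          have := hwle (C (f (eb j)) ((qφ (f (eb j))).succAbove c))
          split_ifs <;> omega
      · obtain ⟨havoid, htop, hlt⟩ := hφ₁ _ hg
        rw [if_neg (havoid _), if_pos htop, if_neg (havoid _)]
        by_cases hq : C (f (eb j)) ((qφ (f (eb j))).succAbove c) ∈ S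
        · rw [if_pos hq]
          have := hlt _ hq hne
          omega
        · rw [if_neg hq]
          omega
    have hT₀ : ∀ j : Fin k, κ (Fin.castAdd m j) 0 ∈ Pm := by
      intro j
      rw [hκ, Fin.cycleRange_symm_zero]
      have hg : grp (f (eb (Fin.castAdd m j))) = false := by rw [← hf, hβ₀]
      exact (hφ₀ _ hg).1
    have hT₁ : ∀ j : Fin m, κ (Fin.natAdd k j) 0 ∉ Pm := by
      intro j
      rw [hκ, Fin.cycleRange_symm_zero]
      have hg : grp (f (eb (Fin.natAdd k j))) = true := by rw [← hf, hβ₁]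
      exact (hφ₁ _ hg).1 _
    -- the two children are the derivable children, enumerated by `e₀`, `e₁`
    have hchild₀ : Q nr nc k d (fun i a => ρ (Fin.castAdd m i) a.succ)
        (fun j c => κ (Fin.castAdd m j) c.succ) := by
      have hρc : (fun (i : Fin k) (a : Fin d) => ρ (Fin.castAdd m i) a.succ) =
          fun i => R ((e₀ i : {x : ι // β x = false}) : ι) ∘
            (pos ((e₀ i : {x : ι // β x = false}) : ι)).succAbove := by
        funext i a
        rw [hρ, heb₀, Fin.cycleRange_symm_succ, Function.comp_apply]
      have hκc : (fun (j : Fin k) (c : Fin d) => κ (Fin.castAdd m j) c.succ) =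
          fun j => C (f ((e₀ j : {x : ι // β x = false}) : ι)) ∘
            (qφ (f ((e₀ j : {x : ι // β x = false}) : ι))).succAbove := by
        funext j c
        rw [hκ, heb₀, Fin.cycleRange_symm_succ, Function.comp_apply]
      rw [hρc, hκc]
      exact ih₀ k e₀
    have hchild₁ : Q nr nc m d (fun i a => ρ (Fin.natAdd k i) a.succ)
        (fun j c => κ (Fin.natAdd k j) c.succ) := by
      have hρc : (fun (i : Fin m) (a : Fin d) => ρ (Fin.natAdd k i) a.succ) =
          fun i => R ((e₁ i : {x : ι // ¬ β x = false}) : ι) ∘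
            (pos ((e₁ i : {x : ι // ¬ β x = false}) : ι)).succAbove := by
        funext i a
        rw [hρ, heb₁, Fin.cycleRange_symm_succ, Function.comp_apply]
      have hκc : (fun (j : Fin m) (c : Fin d) => κ (Fin.natAdd k j) c.succ) =
          fun j => C (f ((e₁ j : {x : ι // ¬ β x = false}) : ι)) ∘
            (qφ (f ((e₁ j : {x : ι // ¬ β x = false}) : ι))).succAbove := by
        funext j c
        rw [hκ, heb₁, Fin.cycleRange_symm_succ, Function.comp_apply]
      rw [hρc, hκc]
      exact ih₁ m e₁
    -- the marked pair move
    have hmain : Q nr nc (k + m) (d + 1) ρ κ :=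
      h3 nr nc k m d ρ κ ℓ₀ ℓ₁ prio Pm hℓ hρ₀' hρ₁' hρ' hprio' hT₀ hT₁ hchild₀ hchild₁
    -- back to the given enumeration by re-indexing
    obtain ⟨σ, hσ⟩ : ∃ σ : Equiv.Perm (Fin (k + m)), ∀ i, en (σ i) = eb i :=
      ⟨eb.trans en.symm, fun i => by simp⟩
    obtain ⟨τ, hτ⟩ : ∃ τ : Equiv.Perm (Fin (k + m)), ∀ j, en (τ j) = f (eb j) :=
      ⟨(eb.trans f).trans en.symm, fun j => by simp⟩
    refine h0 nr nc (k + m) (d + 1) _ _ σ τ (fun i => (Fin.cycleRange (pos (eb i))).symm)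
      (fun j => (Fin.cycleRange (qφ (f (eb j)))).symm) ?_
    have e1 : (fun i a => (fun i => R (en i)) (σ i) ((Fin.cycleRange (pos (eb i))).symm a)) = ρ := by
      funext i a
      show R (en (σ i)) _ = ρ i a
      rw [hρ, hσ]
    have e2 : (fun j c => (fun j => C (en j)) (τ j) ((Fin.cycleRange (qφ (f (eb j)))).symm c))
        = κ := by
      funext j c
      show C (en (τ j)) _ = κ j c
      rw [hκ, hτ]
    rw [e1, e2]
    exact hmain
  | @shear nr nc ι _ _ e R C hC x y hxy aff qx haff hunaff h ih =>
    intro r en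
    refine h4 nr nc r e _ _ x y hxy ?_
    have hmaps : (fun j c => if C (en j) c = x ∧ (∀ c' : Fin e, C (en j) c' ≠ y) then y
        else C (en j) c) =
        fun j => (if aff (en j) then Function.update (C (en j)) (qx (en j)) y else C (en j)) := by
      funext j
      exact shear_map_eq (C (en j)) (hC (en j)) x y (aff (en j)) (qx (en j)) (haff (en j))
        (hunaff (en j))
    rw [hmaps]
    exact ih r en
  | @transpose nr nc ι _ _ e R C h ih =>
    intro r en
    exact h1 nr nc r e _ _ (ih r en)
  | @reindex nr nc ι _ _ e R C σ τ h ih =>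
    intro r en
    refine h0 nr nc r e _ _ ((en.trans σ).trans en.symm) ((en.trans τ).trans en.symm)
      (fun _ => Equiv.refl _) (fun _ => Equiv.refl _) ?_
    have e1 : (fun i a => (fun i => R (en i)) (((en.trans σ).trans en.symm) i) ((Equiv.refl _) a))
        = fun i => R (σ (en i)) := by
      funext i a
      simp
    have e2 : (fun j c => (fun j => C (en j)) (((en.trans τ).trans en.symm) j) ((Equiv.refl _) c))
        = fun j => C (τ (en j)) := by
      funext j c
      simp
    rw [e1, e2]
    exact ih r en

/-- **Corollary.** Gen 7's residual «every injective TT layout has a priority-peeling derivation»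
implies item 19761 `PriorityPeelingCertificatesExist` (the route decl, by name). -/
theorem priorityPeelingCertificatesExist_of_derivations
    (hder : ∀ (h r : ℕ) (u w : Fin r → Finset (Fin h)), Function.Injective u →
      Function.Injective w →
      PPDerivable (h + h) (h + h) (Fin r) h
        (fun i a => if a ∈ u i then Fin.castAdd h a else Fin.natAdd h a)
        (fun j c => if c ∈ w j then Fin.natAdd h c else Fin.castAdd h c)) :
    Theses.BarrierLever.PriorityPeelingCertificatesExist := by
  intro Q h0 h1 h2a h2b h2c _h2d h3 h4 h r u w hu hw
  exact closed_of_ppDerivable Q h0 h1 h2a h2b h2c h3 h4 (hder h r u w hu hw) r (Equiv.refl _)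

end Summit.ValiantsHypothesis.ValiantsHypothesis.Theorems.BarrierLever.PPBridge
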